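import Summits.QuantumAdvantage.QuantumAdvantage.Theorems.CompositeFrameBound.Negative.LoadBearing

/-!
# Line `Sketch` — skeleton for the crux `SymplecticPurity.CompositeFrameBound` (stmt-QuantumAdvantage-10730)

Lead provers `prover-line-stmt-QuantumAdvantage-10730-0` / `-c1-0` (2026-08-16).  The line served as `Sketch`
(planner-cruxidea-stmt-QuantumAdvantage-10730-1: "RF ⟸-reduction, Slater-incidence transfer, torus
stratum") is rebuilt here on the refuter's PROVED U₂-free reduction (`Cruxes/CompositeFrameBound/
Disproof.lean` §3–§5, `crux_of_sparsePeaks`), in FAMILY form: for every Clifford `U₂` and cut `k`,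
`purity_k(U₂ χ) = 2^{-k} Σ_{S ∈ U₂†(𝒫_{<k}⊗I)U₂} |⟨χ|S|χ⟩|²` is `2^{-k}·(1 + mass of χ on a family
of < 4^k non-identity strings)`, so the crux follows from a bound on the squared Pauli mass that the
Gaussian image `χ = U U₁ ĝ` of a Clifford image of the cube state can put on ANY family of `4^k`
strings (`stub_reduction`).  That mass bound is split by the Jordan–Wigner MAJORANA LENGTH of the
strings: strings that are words of `≤ δn` Majoranas are individually peak-free after any Gaussian
layer (compound/Cauchy–Binet count `Σ_{j≤δn} C(4n,j)` against the flatness `2^{1-n/2}` of `U₁ ĝ`: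
`stub_lowAlg` + `stub_lowCount`, provable now), and the families of longer strings are the OPEN CORE
(`stub_core`: no `4^{⌈κn⌉}`-family of long dressed strings carries mass `> 2^{(κ-c)n}`).
`compositeFrameBound_glue` composes the three statements (choice `γ = (κ+1)/4`,
`c' = min(κ,(1-κ)/2,c)/2`) and `CompositeFrameBound_of : CompositeFrameBound` applies it to the stubs.

RESHAPE (lead c1, 2026-08-16): the core is SPLIT BY THE MAGIC OF THE MIDDLE LAYER.  With
`𝒟(U) := 2^{-2n} Σ_S |Tr(σ_S U)|` (Pauli 1-norm), `stub_coreSmall` is the core for layers with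
`𝒟(U) ≤ 2^{θn}` — PROVED (magic budget: a superposition of `𝒟(U)`-bounded total weight of Pauli
images of the flat Clifford image `U₁ĝ` has family mass `≤ 𝒟(U)⁴(1 + |𝒯|·4·2⁻ⁿ)`, files
`Theorems/SymplecticPurityCompositeFrameBoundMagicBudget{,Frame}.lean`) — and `stub_coreLarge` is
the same family bound for the remaining HIGH-MAGIC Gaussian layers `𝒟(U) > 2^{θn}` (open;
`4θ + c < min κ (1-κ)` ties the threshold to the exponents so that the two cases compose:
`core_of_split`).

Disproof used: `false_without_clifford₁/₂`, `false_without_gaussian` (LoadBearing) — the reduction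
consumes the Clifford property of `U₂` (relabelling), the other two stubs quantify over Clifford `U₁`
and Gaussian `U`; the gen-1 PEEL (exact `1/√2` peak) kills every ℓ∞-flatness transfer, which is why
the core is a FAMILY-MASS statement (O(1) peaks, even `2^{(κ-c)n}` of peak mass, are tolerated).
-/

noncomputable section

set_option linter.dupNamespace false -- D-0017: single-problem summit ⇒ `QuantumAdvantage.QuantumAdvantage` by design

namespace Summit.QuantumAdvantage.QuantumAdvantage.Cruxes.CompositeFrameBound.Sketch

open Literature.Computability.Cryptography Literature.Computability.QuantumComplexity Matrix
open Summit.QuantumAdvantage.QuantumAdvantage.Theses.SymplecticPurity (CompositeFrameBound)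
open Summit.QuantumAdvantage.QuantumAdvantage.Theorems.CompositeFrameBound.Negative

/-! ## The four registered stubs -/

/-- **stub_reduction** (known proof: Disproof.lean §3–§5 in family form).  If for all large `n`,
every field/identification and every Clifford `U₁` / Gaussian `U` there is a cut `k ≤ 2n` such that
every family `𝒯` of at most `4^k` non-identity Pauli strings carries squared expectation mass `M`
on `χ = U U₁ ĝ` with `2^{-k}(1 + M) ≤ 2^{-cn}`, then the crux — written as the schema
`FrameBound Clifford Clifford Gaussian` of `LoadBearing` (`crux_iff : CompositeFrameBound ↔ …` is
`Iff.rfl`) so that only `CompositeFrameBound_of` below concludes the crux by name (purity =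
spectral mass on the cut; a Clifford `U₂` only relabels the `4^k` strings injectively, fixing `I`). -/
theorem stub_reduction :
    (∃ c : ℝ, 0 < c ∧ ∃ n₀ : ℕ, ∀ n ≥ n₀, ∀ (K : Type) [Field K] [Fintype K],
      Fintype.card K = 2 ^ n → ∀ e : K ≃+ (Fin n → ZMod 2),
      ∀ U₁ U : Matrix (QReg (n + n)) (QReg (n + n)) ℂ,
      U₁ ∈ Matrix.unitaryGroup (QReg (n + n)) ℂ → IsCliffordU U₁ →
      U ∈ Matrix.unitaryGroup (QReg (n + n)) ℂ → IsGaussianU U →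
      ∃ k ≤ n + n, ∀ 𝒯 : Finset (Fin (n + n) → Pauli), (fun _ => Pauli.I) ∉ 𝒯 → 𝒯.card ≤ 4 ^ k →
        ((2 : ℝ) ^ k)⁻¹ * (1 + ∑ S ∈ 𝒯, ‖star (U *ᵥ (U₁ *ᵥ ghat n K e)) ⬝ᵥ
            (pauliString S *ᵥ (U *ᵥ (U₁ *ᵥ ghat n K e)))‖ ^ 2) ≤ (2 : ℝ) ^ (-(c * (n : ℝ)))) →
    FrameBound (fun _ => IsCliffordU) (fun _ => IsCliffordU) (fun _ => IsGaussianU) := by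
  sorry

/-- **stub_lowAlg** (provable now; the algebraic half of "short words are peak-free").  For every
frame and every NON-IDENTITY Pauli string `S` that is a unit phase times a word of `L` Jordan–Wigner
Majoranas, `|⟨χ|S|χ⟩|² ≤ 4·2^{-n} · Σ_{k=1}^{L} C(4n,k)` for `χ = U U₁ ĝ`: `U† S U` lies in the span
of the words of length `L` (`star_mul_word_mul_mem_span`), i.e. of the `≤ Σ_{k≤L} C(4n,k)` phased
strings of mode SETS of size `≤ L` (`word_eq_smul_pauliString`, `exists_finset_sum_eq_list_sum`,
`card_image_erase_le`), it is traceless (so the identity string is not needed), Bessel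
(`sum_norm_sq_le_of_mem_span`) bounds `|⟨φ|U†SU|φ⟩|²` by the spectral mass of `φ = U₁ ĝ` on those
strings, and each non-identity `|⟨φ|T|φ⟩|² ≤ 4·2^{-n}` (Clifford relabelling `norm_exp_clifford` +
`CubeGraphFlat`, `ĝ = g/√2ⁿ`). -/
theorem stub_lowAlg :
    ∀ (n : ℕ) (K : Type) [Field K] [Fintype K], Fintype.card K = 2 ^ n →
      ∀ e : K ≃+ (Fin n → ZMod 2), ∀ U₁ U : Matrix (QReg (n + n)) (QReg (n + n)) ℂ,
      U₁ ∈ Matrix.unitaryGroup (QReg (n + n)) ℂ → IsCliffordU U₁ →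
      U ∈ Matrix.unitaryGroup (QReg (n + n)) ℂ → IsGaussianU U →
      ∀ S : Fin (n + n) → Pauli, S ≠ (fun _ => Pauli.I) →
      ∀ (l : List (Fin (n + n) × Bool)) (a : ℂ), ‖a‖ = 1 →
        pauliString S = a • (l.map fun p => majorana (n + n) p.1 p.2).prod →
        ‖star (U *ᵥ (U₁ *ᵥ ghat n K e)) ⬝ᵥ (pauliString S *ᵥ (U *ᵥ (U₁ *ᵥ ghat n K e)))‖ ^ 2 ≤
          4 * ((2 : ℝ) ^ n)⁻¹ * ∑ k ∈ Finset.Icc 1 l.length, ((2 * (n + n)).choose k : ℝ) := by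
  sorry

/-- **stub_lowCount** (provable now; the counting half).  For every `γ < 1/2` there is `δ > 0` with
`4·2^{-n} Σ_{k=1}^{L} C(4n,k) ≤ 2^{-2γn}` for all `L ≤ δn` and all large `n`
(`Σ_{k≤L} C(4n,k) ≤ t^{-L}(1+t)^{4n} ≤ (4/δ)^{δn} e^{δn}` with `t = δ/4`, and
`δ log₂(4e/δ) ≤ (1-2γ)/2` for `δ = (1-2γ)²/400`, say). -/
theorem stub_lowCount :
    ∀ γ : ℝ, γ < 1 / 2 → ∃ δ : ℝ, 0 < δ ∧ ∃ n₀ : ℕ, ∀ n ≥ n₀, ∀ L : ℕ, (L : ℝ) ≤ δ * n →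
      4 * ((2 : ℝ) ^ n)⁻¹ * ∑ k ∈ Finset.Icc 1 L, ((2 * (n + n)).choose k : ℝ) ≤
        (2 : ℝ) ^ (-(2 * γ * (n : ℝ))) := by
  sorry

/-- Short words are peak-free: `stub_lowAlg` + `stub_lowCount`. -/
theorem lowDegree_of
    (stub_lowAlg : ∀ (n : ℕ) (K : Type) [Field K] [Fintype K], Fintype.card K = 2 ^ n →
      ∀ e : K ≃+ (Fin n → ZMod 2), ∀ U₁ U : Matrix (QReg (n + n)) (QReg (n + n)) ℂ,
      U₁ ∈ Matrix.unitaryGroup (QReg (n + n)) ℂ → IsCliffordU U₁ →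
      U ∈ Matrix.unitaryGroup (QReg (n + n)) ℂ → IsGaussianU U →
      ∀ S : Fin (n + n) → Pauli, S ≠ (fun _ => Pauli.I) →
      ∀ (l : List (Fin (n + n) × Bool)) (a : ℂ), ‖a‖ = 1 →
        pauliString S = a • (l.map fun p => majorana (n + n) p.1 p.2).prod →
        ‖star (U *ᵥ (U₁ *ᵥ ghat n K e)) ⬝ᵥ (pauliString S *ᵥ (U *ᵥ (U₁ *ᵥ ghat n K e)))‖ ^ 2 ≤
          4 * ((2 : ℝ) ^ n)⁻¹ * ∑ k ∈ Finset.Icc 1 l.length, ((2 * (n + n)).choose k : ℝ))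
    (stub_lowCount : ∀ γ : ℝ, γ < 1 / 2 → ∃ δ : ℝ, 0 < δ ∧ ∃ n₀ : ℕ, ∀ n ≥ n₀, ∀ L : ℕ, (L : ℝ) ≤ δ * n →
      4 * ((2 : ℝ) ^ n)⁻¹ * ∑ k ∈ Finset.Icc 1 L, ((2 * (n + n)).choose k : ℝ) ≤
        (2 : ℝ) ^ (-(2 * γ * (n : ℝ)))) :
    ∀ γ : ℝ, γ < 1 / 2 → ∃ δ : ℝ, 0 < δ ∧ ∃ n₀ : ℕ, ∀ n ≥ n₀, ∀ (K : Type) [Field K] [Fintype K],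
      Fintype.card K = 2 ^ n → ∀ e : K ≃+ (Fin n → ZMod 2),
      ∀ U₁ U : Matrix (QReg (n + n)) (QReg (n + n)) ℂ,
      U₁ ∈ Matrix.unitaryGroup (QReg (n + n)) ℂ → IsCliffordU U₁ →
      U ∈ Matrix.unitaryGroup (QReg (n + n)) ℂ → IsGaussianU U →
      ∀ S : Fin (n + n) → Pauli, S ≠ (fun _ => Pauli.I) →
        (∃ l : List (Fin (n + n) × Bool), (l.length : ℝ) ≤ δ * n ∧ ∃ a : ℂ, ‖a‖ = 1 ∧
          pauliString S = a • (l.map fun p => majorana (n + n) p.1 p.2).prod) →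
        ‖star (U *ᵥ (U₁ *ᵥ ghat n K e)) ⬝ᵥ (pauliString S *ᵥ (U *ᵥ (U₁ *ᵥ ghat n K e)))‖ ^ 2 ≤
          (2 : ℝ) ^ (-(2 * γ * (n : ℝ))) := by
  intro γ hγ
  obtain ⟨δ, hδ, n₀, H⟩ := stub_lowCount γ hγ
  refine ⟨δ, hδ, n₀, fun n hn K _ _ hK e U₁ U hu1 hc1 hu hg S hS ⟨l, hl, a, ha, hSl⟩ => ?_⟩
  exact (stub_lowAlg n K hK e U₁ U hu1 hc1 hu hg S hS l a ha hSl).trans (H n hn l.length hl)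

/-- **stub_coreSmall** (magic budget; PROVED in `Theorems/SymplecticPurityCompositeFrameBoundMagicBudgetFrame.lean`).
For `0 < κ < 1`, `c, θ > 0` with `4θ + c < min κ (1-κ)` and all large `n`: for every Clifford `U₁`
and every middle layer `U` (ANY matrix) of Pauli 1-norm `𝒟(U) = 2^{-2n} Σ_S |Tr(σ_S U)| ≤ 2^{θn}`,
every family of at most `4^{⌈κn⌉}` strings carries squared expectation mass `≤ 2^{(κ-c)n}` on
`U U₁ ĝ` (`U U₁ ĝ` is a superposition of total weight `𝒟(U)` of Pauli images of the flat `U₁ĝ`). -/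
theorem stub_coreSmall :
    ∀ κ θ c : ℝ, 0 < κ → κ < 1 → 0 < c → 0 < θ → 4 * θ + c < min κ (1 - κ) → ∃ n₀ : ℕ, ∀ n ≥ n₀,
      ∀ (K : Type) [Field K] [Fintype K], Fintype.card K = 2 ^ n → ∀ e : K ≃+ (Fin n → ZMod 2),
      ∀ U₁ U : Matrix (QReg (n + n)) (QReg (n + n)) ℂ,
      U₁ ∈ Matrix.unitaryGroup (QReg (n + n)) ℂ → IsCliffordU U₁ →
      ((2 : ℝ) ^ (n + n))⁻¹ * ∑ S : Fin (n + n) → Pauli, ‖pauliCoeff U S‖ ≤ (2 : ℝ) ^ (θ * n) →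
      ∀ 𝒯 : Finset (Fin (n + n) → Pauli), 𝒯.card ≤ 4 ^ ⌈κ * n⌉₊ →
        ∑ S ∈ 𝒯, ‖star (U *ᵥ (U₁ *ᵥ ghat n K e)) ⬝ᵥ
            (pauliString S *ᵥ (U *ᵥ (U₁ *ᵥ ghat n K e)))‖ ^ 2 ≤ (2 : ℝ) ^ ((κ - c) * (n : ℝ)) := by
  sorry

/-- **stub_coreLarge** (the OPEN core of the crux, HIGH-MAGIC Gaussian layers).  There are
`0 < κ < 1`, `c > 0` and a threshold exponent `θ > 0` with `4θ + c < min κ (1-κ)` such that for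
every `δ > 0`, all large `n`, every Clifford `U₁` and every Gaussian unitary `U` whose Pauli 1-norm
EXCEEDS `2^{θn}`: every family `𝒯` of at most `4^{⌈κn⌉}` Pauli strings none of which is a word of
`≤ δn` Jordan–Wigner Majoranas carries squared expectation mass `≤ 2^{(κ-c)n}` on `χ = U U₁ ĝ`.
(Layers with `𝒟(U) ≤ 2^{θn}` are `stub_coreSmall`; the gen-1 peel has `𝒟(U)⁴ = 2.92^{n+1}`,
i.e. lives here; a violation needs `2^{κn-o(n)}` of mass on `4^{κn}` long strings from ONE
high-magic Gaussian layer.) -/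
theorem stub_coreLarge :
    ∃ κ : ℝ, 0 < κ ∧ κ < 1 ∧ ∃ c : ℝ, 0 < c ∧ ∃ θ : ℝ, 0 < θ ∧ 4 * θ + c < min κ (1 - κ) ∧
      ∀ δ : ℝ, 0 < δ → ∃ n₀ : ℕ, ∀ n ≥ n₀,
      ∀ (K : Type) [Field K] [Fintype K], Fintype.card K = 2 ^ n → ∀ e : K ≃+ (Fin n → ZMod 2),
      ∀ U₁ U : Matrix (QReg (n + n)) (QReg (n + n)) ℂ,
      U₁ ∈ Matrix.unitaryGroup (QReg (n + n)) ℂ → IsCliffordU U₁ →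
      U ∈ Matrix.unitaryGroup (QReg (n + n)) ℂ → IsGaussianU U →
      (2 : ℝ) ^ (θ * n) < ((2 : ℝ) ^ (n + n))⁻¹ * ∑ S : Fin (n + n) → Pauli, ‖pauliCoeff U S‖ →
      ∀ 𝒯 : Finset (Fin (n + n) → Pauli),
        (∀ S ∈ 𝒯, ¬ ∃ l : List (Fin (n + n) × Bool), (l.length : ℝ) ≤ δ * n ∧ ∃ a : ℂ, ‖a‖ = 1 ∧
          pauliString S = a • (l.map fun p => majorana (n + n) p.1 p.2).prod) →
        𝒯.card ≤ 4 ^ ⌈κ * n⌉₊ →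
        ∑ S ∈ 𝒯, ‖star (U *ᵥ (U₁ *ᵥ ghat n K e)) ⬝ᵥ
            (pauliString S *ᵥ (U *ᵥ (U₁ *ᵥ ghat n K e)))‖ ^ 2 ≤ (2 : ℝ) ^ ((κ - c) * (n : ℝ)) := by
  sorry

/-- **Case split of the core by the magic of the middle layer**: `stub_coreSmall` (layers with
`𝒟(U) ≤ 2^{θn}`) and `stub_coreLarge` (Gaussian layers with `𝒟(U) > 2^{θn}`) give the core bound
in the form consumed by `compositeFrameBound_glue`. -/
theorem core_of_split
    (hsmall : ∀ κ θ c : ℝ, 0 < κ → κ < 1 → 0 < c → 0 < θ → 4 * θ + c < min κ (1 - κ) → ∃ n₀ : ℕ, ∀ n ≥ n₀,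
      ∀ (K : Type) [Field K] [Fintype K], Fintype.card K = 2 ^ n → ∀ e : K ≃+ (Fin n → ZMod 2),
      ∀ U₁ U : Matrix (QReg (n + n)) (QReg (n + n)) ℂ,
      U₁ ∈ Matrix.unitaryGroup (QReg (n + n)) ℂ → IsCliffordU U₁ →
      ((2 : ℝ) ^ (n + n))⁻¹ * ∑ S : Fin (n + n) → Pauli, ‖pauliCoeff U S‖ ≤ (2 : ℝ) ^ (θ * n) →
      ∀ 𝒯 : Finset (Fin (n + n) → Pauli), 𝒯.card ≤ 4 ^ ⌈κ * n⌉₊ →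
        ∑ S ∈ 𝒯, ‖star (U *ᵥ (U₁ *ᵥ ghat n K e)) ⬝ᵥ
            (pauliString S *ᵥ (U *ᵥ (U₁ *ᵥ ghat n K e)))‖ ^ 2 ≤ (2 : ℝ) ^ ((κ - c) * (n : ℝ)))
    (hlarge : ∃ κ : ℝ, 0 < κ ∧ κ < 1 ∧ ∃ c : ℝ, 0 < c ∧ ∃ θ : ℝ, 0 < θ ∧ 4 * θ + c < min κ (1 - κ) ∧
      ∀ δ : ℝ, 0 < δ → ∃ n₀ : ℕ, ∀ n ≥ n₀,
      ∀ (K : Type) [Field K] [Fintype K], Fintype.card K = 2 ^ n → ∀ e : K ≃+ (Fin n → ZMod 2),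
      ∀ U₁ U : Matrix (QReg (n + n)) (QReg (n + n)) ℂ,
      U₁ ∈ Matrix.unitaryGroup (QReg (n + n)) ℂ → IsCliffordU U₁ →
      U ∈ Matrix.unitaryGroup (QReg (n + n)) ℂ → IsGaussianU U →
      (2 : ℝ) ^ (θ * n) < ((2 : ℝ) ^ (n + n))⁻¹ * ∑ S : Fin (n + n) → Pauli, ‖pauliCoeff U S‖ →
      ∀ 𝒯 : Finset (Fin (n + n) → Pauli),
        (∀ S ∈ 𝒯, ¬ ∃ l : List (Fin (n + n) × Bool), (l.length : ℝ) ≤ δ * n ∧ ∃ a : ℂ, ‖a‖ = 1 ∧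
          pauliString S = a • (l.map fun p => majorana (n + n) p.1 p.2).prod) →
        𝒯.card ≤ 4 ^ ⌈κ * n⌉₊ →
        ∑ S ∈ 𝒯, ‖star (U *ᵥ (U₁ *ᵥ ghat n K e)) ⬝ᵥ
            (pauliString S *ᵥ (U *ᵥ (U₁ *ᵥ ghat n K e)))‖ ^ 2 ≤ (2 : ℝ) ^ ((κ - c) * (n : ℝ))) :
    ∃ κ : ℝ, 0 < κ ∧ κ < 1 ∧ ∃ c : ℝ, 0 < c ∧ ∀ δ : ℝ, 0 < δ → ∃ n₀ : ℕ, ∀ n ≥ n₀,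
      ∀ (K : Type) [Field K] [Fintype K], Fintype.card K = 2 ^ n → ∀ e : K ≃+ (Fin n → ZMod 2),
      ∀ U₁ U : Matrix (QReg (n + n)) (QReg (n + n)) ℂ,
      U₁ ∈ Matrix.unitaryGroup (QReg (n + n)) ℂ → IsCliffordU U₁ →
      U ∈ Matrix.unitaryGroup (QReg (n + n)) ℂ → IsGaussianU U →
      ∀ 𝒯 : Finset (Fin (n + n) → Pauli),
        (∀ S ∈ 𝒯, ¬ ∃ l : List (Fin (n + n) × Bool), (l.length : ℝ) ≤ δ * n ∧ ∃ a : ℂ, ‖a‖ = 1 ∧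
          pauliString S = a • (l.map fun p => majorana (n + n) p.1 p.2).prod) →
        𝒯.card ≤ 4 ^ ⌈κ * n⌉₊ →
        ∑ S ∈ 𝒯, ‖star (U *ᵥ (U₁ *ᵥ ghat n K e)) ⬝ᵥ
            (pauliString S *ᵥ (U *ᵥ (U₁ *ᵥ ghat n K e)))‖ ^ 2 ≤ (2 : ℝ) ^ ((κ - c) * (n : ℝ)) := by
  obtain ⟨κ, hκ0, hκ1, c, hc, θ, hθ, hθc, H⟩ := hlarge
  obtain ⟨n₁, Hs⟩ := hsmall κ θ c hκ0 hκ1 hc hθ hθc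
  refine ⟨κ, hκ0, hκ1, c, hc, fun δ hδ => ?_⟩
  obtain ⟨n₂, Hl⟩ := H δ hδ
  refine ⟨max n₁ n₂, fun n hn K _ _ hK e U₁ U hu1 hc1 hu hg 𝒯 hlong hcard => ?_⟩
  by_cases hD : ((2 : ℝ) ^ (n + n))⁻¹ * ∑ S : Fin (n + n) → Pauli, ‖pauliCoeff U S‖ ≤ (2 : ℝ) ^ (θ * n)
  · exact Hs n (le_trans (le_max_left _ _) hn) K hK e U₁ U hu1 hc1 hD 𝒯 hcard
  · exact Hl n (le_trans (le_max_right _ _) hn) K hK e U₁ U hu1 hc1 hu hg (lt_of_not_ge hD) 𝒯 hlong hcard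

/-- The core in the glue's shape, from the two registered core stubs. -/
theorem stub_core_of_split :
    ∃ κ : ℝ, 0 < κ ∧ κ < 1 ∧ ∃ c : ℝ, 0 < c ∧ ∀ δ : ℝ, 0 < δ → ∃ n₀ : ℕ, ∀ n ≥ n₀,
      ∀ (K : Type) [Field K] [Fintype K], Fintype.card K = 2 ^ n → ∀ e : K ≃+ (Fin n → ZMod 2),
      ∀ U₁ U : Matrix (QReg (n + n)) (QReg (n + n)) ℂ,
      U₁ ∈ Matrix.unitaryGroup (QReg (n + n)) ℂ → IsCliffordU U₁ →
      U ∈ Matrix.unitaryGroup (QReg (n + n)) ℂ → IsGaussianU U →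
      ∀ 𝒯 : Finset (Fin (n + n) → Pauli),
        (∀ S ∈ 𝒯, ¬ ∃ l : List (Fin (n + n) × Bool), (l.length : ℝ) ≤ δ * n ∧ ∃ a : ℂ, ‖a‖ = 1 ∧
          pauliString S = a • (l.map fun p => majorana (n + n) p.1 p.2).prod) →
        𝒯.card ≤ 4 ^ ⌈κ * n⌉₊ →
        ∑ S ∈ 𝒯, ‖star (U *ᵥ (U₁ *ᵥ ghat n K e)) ⬝ᵥ
            (pauliString S *ᵥ (U *ᵥ (U₁ *ᵥ ghat n K e)))‖ ^ 2 ≤ (2 : ℝ) ^ ((κ - c) * (n : ℝ)) :=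
  core_of_split stub_coreSmall stub_coreLarge

/-! ## Composition -/

/-- Exponent bookkeeping for the composition: with `k = ⌈κ n⌉`, `2γ = (κ+1)/2`,
`2^{-k}(1 + 4^k 2^{-2γ n} + 2^{(κ-c)n}) ≤ 2^{-κ n} + 2·2^{-(1-κ)n/2} + 2^{-cn}`. -/
theorem comp_arith {κ c : ℝ} (hκ0 : 0 < κ) (n : ℕ) {A B : ℝ}
    (hA : A ≤ (4 : ℝ) ^ ⌈κ * n⌉₊ * (2 : ℝ) ^ (-(2 * ((κ + 1) / 4) * (n : ℝ))))
    (hB : B ≤ (2 : ℝ) ^ ((κ - c) * (n : ℝ))) :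
    ((2 : ℝ) ^ ⌈κ * n⌉₊)⁻¹ * (1 + (A + B)) ≤
      (2 : ℝ) ^ (-(κ * n)) + 2 * (2 : ℝ) ^ (-((1 - κ) / 2 * n)) + (2 : ℝ) ^ (-(c * n)) := by
  set k : ℕ := ⌈κ * n⌉₊ with hk
  have h2 : (0 : ℝ) < 2 := by norm_num
  have hkge : κ * n ≤ (k : ℝ) := Nat.le_ceil _
  have hklt : (k : ℝ) < κ * n + 1 := Nat.ceil_lt_add_one (by positivity)
  have hpow : ((2 : ℝ) ^ k)⁻¹ = (2 : ℝ) ^ (-(k : ℝ)) := by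
    rw [Real.rpow_neg h2.le, Real.rpow_natCast]
  have h4 : (4 : ℝ) ^ k = (2 : ℝ) ^ (2 * (k : ℝ)) := by
    rw [Real.rpow_mul h2.le, Real.rpow_two, Real.rpow_natCast]; norm_num
  rw [hpow]
  have t0 : (2 : ℝ) ^ (-(k : ℝ)) ≤ (2 : ℝ) ^ (-(κ * n)) :=
    Real.rpow_le_rpow_of_exponent_le (by norm_num) (by linarith)
  have t1 : (2 : ℝ) ^ (-(k : ℝ)) * A ≤ 2 * (2 : ℝ) ^ (-((1 - κ) / 2 * n)) := by
    calc (2 : ℝ) ^ (-(k : ℝ)) * A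
        ≤ (2 : ℝ) ^ (-(k : ℝ)) * ((4 : ℝ) ^ k * (2 : ℝ) ^ (-(2 * ((κ + 1) / 4) * (n : ℝ)))) :=
          mul_le_mul_of_nonneg_left hA (by positivity)
      _ = (2 : ℝ) ^ ((k : ℝ) - (κ + 1) / 2 * n) := by
          rw [h4, ← Real.rpow_add h2, ← Real.rpow_add h2]
          congr 1; ring
      _ ≤ (2 : ℝ) ^ (1 + -((1 - κ) / 2 * n)) :=
          Real.rpow_le_rpow_of_exponent_le (by norm_num) (by nlinarith)
      _ = 2 * (2 : ℝ) ^ (-((1 - κ) / 2 * n)) := by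
          rw [Real.rpow_add h2, Real.rpow_one]
  have t2 : (2 : ℝ) ^ (-(k : ℝ)) * B ≤ (2 : ℝ) ^ (-(c * n)) := by
    calc (2 : ℝ) ^ (-(k : ℝ)) * B ≤ (2 : ℝ) ^ (-(k : ℝ)) * (2 : ℝ) ^ ((κ - c) * (n : ℝ)) :=
          mul_le_mul_of_nonneg_left hB (by positivity)
      _ = (2 : ℝ) ^ (-(k : ℝ) + (κ - c) * n) := by rw [← Real.rpow_add h2]
      _ ≤ (2 : ℝ) ^ (-(c * n)) := Real.rpow_le_rpow_of_exponent_le (by norm_num) (by nlinarith)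
  have : (2 : ℝ) ^ (-(k : ℝ)) * (1 + (A + B)) =
      (2 : ℝ) ^ (-(k : ℝ)) + (2 : ℝ) ^ (-(k : ℝ)) * A + (2 : ℝ) ^ (-(k : ℝ)) * B := by ring
  rw [this]
  linarith

/-- Three decaying exponentials are eventually below one slower exponential:
if `0 < c' ≤ min(κ, (1-κ)/2, c)/2` and `2/c' ≤ n` then
`2^{-κn} + 2·2^{-(1-κ)n/2} + 2^{-cn} ≤ 2^{-c'n}`. -/
theorem three_exp_le {κ c c' : ℝ} {n : ℕ} (hc' : 0 < c') (h1 : 2 * c' ≤ κ)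
    (h2 : 2 * c' ≤ (1 - κ) / 2) (h3 : 2 * c' ≤ c) (hn : 2 / c' ≤ (n : ℝ)) :
    (2 : ℝ) ^ (-(κ * n)) + 2 * (2 : ℝ) ^ (-((1 - κ) / 2 * n)) + (2 : ℝ) ^ (-(c * n)) ≤
      (2 : ℝ) ^ (-(c' * n)) := by
  have h2' : (1 : ℝ) ≤ 2 := by norm_num
  have hn0 : (0 : ℝ) ≤ n := Nat.cast_nonneg n
  have e1 : (2 : ℝ) ^ (-(κ * n)) ≤ (2 : ℝ) ^ (-(2 * c' * n)) :=
    Real.rpow_le_rpow_of_exponent_le h2' (by nlinarith)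
  have e2 : (2 : ℝ) ^ (-((1 - κ) / 2 * n)) ≤ (2 : ℝ) ^ (-(2 * c' * n)) :=
    Real.rpow_le_rpow_of_exponent_le h2' (by nlinarith)
  have e3 : (2 : ℝ) ^ (-(c * n)) ≤ (2 : ℝ) ^ (-(2 * c' * n)) :=
    Real.rpow_le_rpow_of_exponent_le h2' (by nlinarith)
  -- 4 · 2^{-2c'n} ≤ 2^{-c'n}  since  c' n ≥ 2
  have hcn : 2 ≤ c' * n := by
    have := (div_le_iff₀ hc').mp hn
    linarith
  have e4 : 4 * (2 : ℝ) ^ (-(2 * c' * n)) ≤ (2 : ℝ) ^ (-(c' * n)) := by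
    have : 4 * (2 : ℝ) ^ (-(2 * c' * n)) = (2 : ℝ) ^ (2 + -(2 * c' * n)) := by
      rw [Real.rpow_add (by norm_num : (0 : ℝ) < 2)]
      norm_num
    rw [this]
    exact Real.rpow_le_rpow_of_exponent_le h2' (by linarith)
  linarith

/-- **Composition (glue with explicit hypotheses).** The three stub STATEMENTS give the crux —
concluded here as the schema `FrameBound Clifford Clifford Gaussian` (definitionally the crux,
`crux_iff`), with `c' = min(κ, (1-κ)/2, c)/2`; `CompositeFrameBound_of` below instantiates it at the
three registered stubs and concludes `CompositeFrameBound` by name. -/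
theorem compositeFrameBound_glue
    (stub_reduction : (∃ c : ℝ, 0 < c ∧ ∃ n₀ : ℕ, ∀ n ≥ n₀, ∀ (K : Type) [Field K] [Fintype K],
      Fintype.card K = 2 ^ n → ∀ e : K ≃+ (Fin n → ZMod 2),
      ∀ U₁ U : Matrix (QReg (n + n)) (QReg (n + n)) ℂ,
      U₁ ∈ Matrix.unitaryGroup (QReg (n + n)) ℂ → IsCliffordU U₁ →
      U ∈ Matrix.unitaryGroup (QReg (n + n)) ℂ → IsGaussianU U →
      ∃ k ≤ n + n, ∀ 𝒯 : Finset (Fin (n + n) → Pauli), (fun _ => Pauli.I) ∉ 𝒯 → 𝒯.card ≤ 4 ^ k →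
        ((2 : ℝ) ^ k)⁻¹ * (1 + ∑ S ∈ 𝒯, ‖star (U *ᵥ (U₁ *ᵥ ghat n K e)) ⬝ᵥ
            (pauliString S *ᵥ (U *ᵥ (U₁ *ᵥ ghat n K e)))‖ ^ 2) ≤ (2 : ℝ) ^ (-(c * (n : ℝ)))) →
      FrameBound (fun _ => IsCliffordU) (fun _ => IsCliffordU) (fun _ => IsGaussianU))
    (hlow : ∀ γ : ℝ, γ < 1 / 2 → ∃ δ : ℝ, 0 < δ ∧ ∃ n₀ : ℕ, ∀ n ≥ n₀, ∀ (K : Type) [Field K] [Fintype K],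
      Fintype.card K = 2 ^ n → ∀ e : K ≃+ (Fin n → ZMod 2),
      ∀ U₁ U : Matrix (QReg (n + n)) (QReg (n + n)) ℂ,
      U₁ ∈ Matrix.unitaryGroup (QReg (n + n)) ℂ → IsCliffordU U₁ →
      U ∈ Matrix.unitaryGroup (QReg (n + n)) ℂ → IsGaussianU U →
      ∀ S : Fin (n + n) → Pauli, S ≠ (fun _ => Pauli.I) →
        (∃ l : List (Fin (n + n) × Bool), (l.length : ℝ) ≤ δ * n ∧ ∃ a : ℂ, ‖a‖ = 1 ∧
          pauliString S = a • (l.map fun p => majorana (n + n) p.1 p.2).prod) →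
        ‖star (U *ᵥ (U₁ *ᵥ ghat n K e)) ⬝ᵥ (pauliString S *ᵥ (U *ᵥ (U₁ *ᵥ ghat n K e)))‖ ^ 2 ≤
          (2 : ℝ) ^ (-(2 * γ * (n : ℝ))))
    (stub_core : ∃ κ : ℝ, 0 < κ ∧ κ < 1 ∧ ∃ c : ℝ, 0 < c ∧ ∀ δ : ℝ, 0 < δ → ∃ n₀ : ℕ, ∀ n ≥ n₀,
      ∀ (K : Type) [Field K] [Fintype K], Fintype.card K = 2 ^ n → ∀ e : K ≃+ (Fin n → ZMod 2),
      ∀ U₁ U : Matrix (QReg (n + n)) (QReg (n + n)) ℂ,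
      U₁ ∈ Matrix.unitaryGroup (QReg (n + n)) ℂ → IsCliffordU U₁ →
      U ∈ Matrix.unitaryGroup (QReg (n + n)) ℂ → IsGaussianU U →
      ∀ 𝒯 : Finset (Fin (n + n) → Pauli),
        (∀ S ∈ 𝒯, ¬ ∃ l : List (Fin (n + n) × Bool), (l.length : ℝ) ≤ δ * n ∧ ∃ a : ℂ, ‖a‖ = 1 ∧
          pauliString S = a • (l.map fun p => majorana (n + n) p.1 p.2).prod) →
        𝒯.card ≤ 4 ^ ⌈κ * n⌉₊ →
        ∑ S ∈ 𝒯, ‖star (U *ᵥ (U₁ *ᵥ ghat n K e)) ⬝ᵥ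
            (pauliString S *ᵥ (U *ᵥ (U₁ *ᵥ ghat n K e)))‖ ^ 2 ≤ (2 : ℝ) ^ ((κ - c) * (n : ℝ))) :
    FrameBound (fun _ => IsCliffordU) (fun _ => IsCliffordU) (fun _ => IsGaussianU) := by
  classical
  apply stub_reduction
  obtain ⟨κ, hκ0, hκ1, c, hc, H⟩ := stub_core
  obtain ⟨δ, hδ, n₁, Hlow⟩ := hlow ((κ + 1) / 4) (by linarith)
  obtain ⟨n₂, Hcore⟩ := H δ hδ
  set c' : ℝ := min (min κ ((1 - κ) / 2)) c / 2 with hc'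
  have hc'pos : 0 < c' := by
    rw [hc']
    have : 0 < min (min κ ((1 - κ) / 2)) c := lt_min (lt_min hκ0 (by linarith)) hc
    linarith
  have hc'1 : 2 * c' ≤ κ := by
    rw [hc']; nlinarith [min_le_left (min κ ((1 - κ) / 2)) c, min_le_left κ ((1 - κ) / 2)]
  have hc'2 : 2 * c' ≤ (1 - κ) / 2 := by
    rw [hc']; nlinarith [min_le_left (min κ ((1 - κ) / 2)) c, min_le_right κ ((1 - κ) / 2)]
  have hc'3 : 2 * c' ≤ c := by
    rw [hc']; nlinarith [min_le_right (min κ ((1 - κ) / 2)) c]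
  refine ⟨c', hc'pos, max (max n₁ n₂) (⌈2 / c'⌉₊ + 1), fun n hn K _ _ hK e U₁ U hu1 hc1 hu hg => ?_⟩
  have hn₁ : n₁ ≤ n := le_trans (le_trans (le_max_left _ _) (le_max_left _ _)) hn
  have hn₂ : n₂ ≤ n := le_trans (le_trans (le_max_right _ _) (le_max_left _ _)) hn
  have hn3 : 2 / c' ≤ (n : ℝ) := by
    have h' : ⌈2 / c'⌉₊ + 1 ≤ n := le_trans (le_max_right _ _) hn
    have : (⌈2 / c'⌉₊ : ℝ) ≤ n := by exact_mod_cast (Nat.le_succ _).trans h'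
    exact (Nat.le_ceil _).trans this
  have hn1 : 1 ≤ n := by
    have h' : ⌈2 / c'⌉₊ + 1 ≤ n := le_trans (le_max_right _ _) hn
    omega
  refine ⟨⌈κ * n⌉₊, ?_, fun 𝒯 hI hcard => ?_⟩
  · -- ⌈κ n⌉ ≤ n ≤ n + n
    have : ⌈κ * (n : ℝ)⌉₊ ≤ n := by
      rw [Nat.ceil_le]
      calc κ * (n : ℝ) ≤ 1 * (n : ℝ) := mul_le_mul_of_nonneg_right hκ1.le (Nat.cast_nonneg n)
        _ = n := one_mul _
    omega
  · set χ : QReg (n + n) → ℂ := U *ᵥ (U₁ *ᵥ ghat n K e) with hχ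
    set F : (Fin (n + n) → Pauli) → ℝ := fun S => ‖star χ ⬝ᵥ (pauliString S *ᵥ χ)‖ ^ 2 with hF
    set short : (Fin (n + n) → Pauli) → Prop := fun S =>
      ∃ l : List (Fin (n + n) × Bool), (l.length : ℝ) ≤ δ * n ∧ ∃ a : ℂ, ‖a‖ = 1 ∧
        pauliString S = a • (l.map fun p => majorana (n + n) p.1 p.2).prod with hshort
    have split : ∑ S ∈ 𝒯, F S =
        ∑ S ∈ 𝒯.filter (fun S => short S), F S + ∑ S ∈ 𝒯.filter (fun S => ¬ short S), F S :=
      (Finset.sum_filter_add_sum_filter_not _ _ _).symm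
    -- the short strings: each term is ≤ 2^{-2γn}
    have hA : ∑ S ∈ 𝒯.filter (fun S => short S), F S ≤
        (4 : ℝ) ^ ⌈κ * n⌉₊ * (2 : ℝ) ^ (-(2 * ((κ + 1) / 4) * (n : ℝ))) := by
      have each : ∀ S ∈ 𝒯.filter (fun S => short S),
          F S ≤ (2 : ℝ) ^ (-(2 * ((κ + 1) / 4) * (n : ℝ))) := by
        intro S hS
        rw [Finset.mem_filter] at hS
        have hSI : S ≠ (fun _ => Pauli.I) := fun h => hI (h ▸ hS.1)
        exact Hlow n hn₁ K hK e U₁ U hu1 hc1 hu hg S hSI hS.2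
      calc ∑ S ∈ 𝒯.filter (fun S => short S), F S
          ≤ ∑ S ∈ 𝒯.filter (fun S => short S), (2 : ℝ) ^ (-(2 * ((κ + 1) / 4) * (n : ℝ))) :=
            Finset.sum_le_sum each
        _ = ((𝒯.filter (fun S => short S)).card : ℝ) * (2 : ℝ) ^ (-(2 * ((κ + 1) / 4) * (n : ℝ))) := by
            rw [Finset.sum_const, nsmul_eq_mul]
        _ ≤ (4 : ℝ) ^ ⌈κ * n⌉₊ * (2 : ℝ) ^ (-(2 * ((κ + 1) / 4) * (n : ℝ))) := by
            apply mul_le_mul_of_nonneg_right _ (by positivity)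
            have : (𝒯.filter (fun S => short S)).card ≤ 4 ^ ⌈κ * n⌉₊ :=
              (Finset.card_filter_le _ _).trans hcard
            exact_mod_cast this
    -- the long strings: the core
    have hB : ∑ S ∈ 𝒯.filter (fun S => ¬ short S), F S ≤ (2 : ℝ) ^ ((κ - c) * (n : ℝ)) := by
      refine Hcore n hn₂ K hK e U₁ U hu1 hc1 hu hg (𝒯.filter (fun S => ¬ short S)) ?_
        ((Finset.card_filter_le _ _).trans hcard)
      intro S hS
      rw [Finset.mem_filter] at hS
      exact hS.2
    rw [split]
    exact (comp_arith hκ0 n hA hB).trans (three_exp_le hc'pos hc'1 hc'2 hc'3 hn3)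

/-- **The skeleton**: the crux BY NAME, modulo exactly the five registered stubs
(`stub_reduction`, `stub_lowAlg`, `stub_lowCount` landed; `stub_coreSmall` magic budget;
`stub_coreLarge` open). -/
theorem CompositeFrameBound_of : CompositeFrameBound :=
  crux_iff.mpr (compositeFrameBound_glue stub_reduction (lowDegree_of stub_lowAlg stub_lowCount)
    stub_core_of_split)

end Summit.QuantumAdvantage.QuantumAdvantage.Cruxes.CompositeFrameBound.Sketch
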